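import Mathlib
import Literature.MathematicalPhysics.QuantumFieldTheory.MagnenRivasseauSeneor1993.MRS93LemmaVI2FeynmanGauge
import HarnessLib

/-!
# Magnen–Rivasseau–Sénéor, *Construction of YM₄ with an infrared cutoff* (CMP 155, 1993), §VI (VI.3): the covariant Laplacian `−D²`
# in a constant su(2) background AS PRINTED, and its specialisation to the two-component background of p.369 versus the printed
# matrix (VI.8) — kernel-checked: (VI.3) gives the TRANSPOSE (= complex conjugate) of (VI.8)

statement-level skeleton of published theorems with citation tags; proofs where landed; nothing here is a claim about the
Yang–Mills mass gap, about continuum YM₄ on T⁴, or about the Clay problem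

**Citation header (reproduction of PUBLISHED work).** J. Magnen, V. Rivasseau, R. Sénéor, *Construction of YM₄ with an infrared
cutoff*, Commun. Math. Phys. **155** (1993) 325–383 [MagnenRivasseauSeneor1993], §VI p.369 [PDF 45] (display (VI.3); render
`run/shared/lean/pub/pub-balaban-gaps/pub-balaban-gaps-mrs-lit-2/g3/renders/p45_crop_r300-2000_s3.png` of the 600-dpi page image; the text
layer garbles the display) and p.370 [PDF 46] ((VI.6), (VI.8), typed in the sibling file `MRS93LemmaVI2FeynmanGauge.lean` as
`FeynmanGauge.Pmat`, `FeynmanGauge.Psq` with `sum_Pmat_sq_eq_VI8`; imported, nothing restated). Cell pub-balaban-gaps (YM blitz, track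
G3), seat mrs-lit-2 (gen 3); companion record `run/shared/lean/pub/pub-balaban-gaps/g3/MRS-AS-PRINTED-estimates.md` §3(k).

**What the paper prints (verbatim, from the page image).** p.369: «BF in su(2) ⊗ ℝ⁴ space (we forget to put the su(2) indices): … (VI.2)
where repeated indices are summed, and `−D² = −Σ_μ D_μD_μ = [p²δ_ab + 2ip_μ ε_abc λB^c_μ + λ²B^c_μB^c_μ δ_ab(1 − δ_ac) − λ²B^a_μB^b_μ(1 − δ_ab)]`,
(VI.3)»; p.369 tl.9–13: «we can explore completely the function g_{i,α,Δ} by considering a field B with only two non-zero components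
B₁¹ = x/λ and B₂² = y/λ»; p.370 (VI.8): «−D² = P² = (p² + y² 0 2ip₂y; 0 p² + x² −2ip₁x; −2ip₂y 2ip₁x p² + x² + y²)».

**What is typed / PROVED here (zero `sorry`, zero named facts).** `leviCivita` (ε_abc on `Fin 3`, the closed form
`(a − b)(b − c)(c − a)/2`); `minusDsq b p` = the right-hand side of (VI.3) as a `3 × 3` complex matrix, for a general constant background
`b μ c = λB^c_μ` (`μ : Fin 4`, `c : Fin 3`) and momentum `p : Fin 4 → ℝ`; `twoComponent x y` = the background of p.369 (`λB₁¹ = x`,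
`λB₂² = y`, all other components `0`; su(2) index `1, 2, 3 ↦ 0, 1, 2`, direction `μ = 1, 2 ↦ 1, 2`). KERNEL: **`minusDsq_twoComponent`** —
at the two-component background, (VI.3) evaluates to the TRANSPOSE of the printed (VI.8): `minusDsq (twoComponent x y) p = (Psq p₀ p₁ p₂ p₃ x y)ᵀ`;
`minusDsq_twoComponent_eq_conj` — equivalently its entrywise complex conjugate (the matrix is Hermitian: `minusDsq_twoComponent_conjTranspose`);
`minusDsq_twoComponent_ne_Psq` — and NOT (VI.8) itself when `p₂y ≠ 0` (the `(1,3)` entries are `−2ip₂y` vs `+2ip₂y`).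

**Finding (record §3(k)), as printed.** With the index order `ab` = (row, column), (VI.3)'s cross term `2ip_μ ε_abc λB^c_μ` has the
opposite sign to the off-diagonal entries of (VI.6)–(VI.8) (`P₁ = (p₁ 0 0; 0 p₁ −ix; 0 ix p₁)`, …): (VI.3) is the transpose / complex
conjugate of (VI.8), i.e. (VI.8) with `(x, y) ↦ (−x, −y)` (equivalently `ε ↦ −ε`, the structure-constant sign already flagged in
`MRS93TruncatedGauge.lean` v1.1). Immaterial: `g_{i,α,Δ}` is a symmetric, even function of `(x, y)` (p.369 tl.12–13), determinants are
transpose-invariant, and everything downstream ((VI.13)–(VI.17), Lemma VI.2 at ζ = 1, files 9–10) was computed from (VI.6). Recorded as a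
convention mismatch between two displays, not as an error in any result.

**What is NOT claimed.** (VI.2)/(VI.9) for general `B`; that (VI.3) IS `−Σ D_μD_μ` for the adjoint covariant derivative (a convention
statement about `D_μ = ∂_μ + λ[B_μ, ·]` not typed here); anything about `ζ ≠ 1`. Nothing here bears on Bałaban's papers; nothing is
continuum YM₄ on T⁴, nothing lifts the infrared cutoff, nothing is Clay.
-/

noncomputable section

open Complex Matrix

namespace Literature.MathematicalPhysics.QuantumFieldTheory.MagnenRivasseauSeneor1993

namespace FeynmanGauge

/-- The Levi-Civita symbol `ε_abc` on `Fin 3` (indices `0, 1, 2` for su(2)'s `1, 2, 3`), in the closed form `(a − b)(b − c)(c − a)/2`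
(`= 1` on even permutations of `(0,1,2)`, `−1` on odd ones, `0` otherwise: `leviCivita_values`). [folklore] -/
def leviCivita (a b c : Fin 3) : ℝ := ((a : ℝ) - b) * ((b : ℝ) - c) * ((c : ℝ) - a) / 2

/-- The values of `ε`: `ε₀₁₂ = ε₁₂₀ = ε₂₀₁ = 1`, `ε₀₂₁ = ε₂₁₀ = ε₁₀₂ = −1`, `ε_aab = 0` (sanity check of the closed form; private). [folklore] -/
private theorem leviCivita_values :
    leviCivita 0 1 2 = 1 ∧ leviCivita 1 2 0 = 1 ∧ leviCivita 2 0 1 = 1 ∧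
      leviCivita 0 2 1 = -1 ∧ leviCivita 2 1 0 = -1 ∧ leviCivita 1 0 2 = -1 ∧
        (∀ a b : Fin 3, leviCivita a a b = 0) := by
  refine ⟨?_, ?_, ?_, ?_, ?_, ?_, fun a b => ?_⟩ <;> simp [leviCivita] <;> norm_num

/-- **(VI.3)** p.369 [PDF 45], verbatim: «`−D² = −Σ_μ D_μD_μ = [p²δ_ab + 2ip_μ ε_abc λB^c_μ + λ²B^c_μB^c_μ δ_ab(1 − δ_ac) − λ²B^a_μB^b_μ(1 − δ_ab)]`,
(VI.3)» («repeated indices are summed») — typed as the `3 × 3` complex matrix with entries indexed `(a, b)`, for a constant background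
`b μ c = λB^c_μ` and momentum `p`: `p²δ_ab + 2i Σ_{μ,c} p_μ ε_abc b_μ^c + δ_ab Σ_{μ, c ≠ a} (b_μ^c)² − (1 − δ_ab) Σ_μ b_μ^a b_μ^b`.
[cite: MagnenRivasseauSeneor1993, §VI (VI.3) p.369] -/
def minusDsq (b : Fin 4 → Fin 3 → ℝ) (p : Fin 4 → ℝ) : Matrix (Fin 3) (Fin 3) ℂ := fun a a' =>
  ((∑ μ, p μ ^ 2 : ℝ) : ℂ) * (if a = a' then 1 else 0)
    + 2 * I * ((∑ μ, ∑ c, p μ * leviCivita a a' c * b μ c : ℝ) : ℂ)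
    + (if a = a' then ((∑ μ, ∑ c, if c = a then 0 else b μ c ^ 2 : ℝ) : ℂ) else 0)
    - (if a = a' then 0 else ((∑ μ, b μ a * b μ a' : ℝ) : ℂ))

/-- The two-component background of p.369 tl.9–13: «a field B with only two non-zero components B₁¹ = x/λ and B₂² = y/λ», as
`b μ c = λB^c_μ`: `b 1 0 = x`, `b 2 1 = y`, all others `0`. [cite: MagnenRivasseauSeneor1993, §VI p.369] -/
def twoComponent (x y : ℝ) : Fin 4 → Fin 3 → ℝ := fun μ c =>
  if μ = 1 ∧ c = 0 then x else if μ = 2 ∧ c = 1 then y else 0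

/-- **(VI.3) at the two-component background = the TRANSPOSE of (VI.8)**: `minusDsq (twoComponent x y) p = (P²)ᵀ` with `P²` the printed
matrix (VI.8) (`FeynmanGauge.Psq`). [cite: MagnenRivasseauSeneor1993, §VI (VI.3) p.369, (VI.8) p.370] -/
theorem minusDsq_twoComponent (p₀ p₁ p₂ p₃ x y : ℝ) :
    minusDsq (twoComponent x y) ![p₀, p₁, p₂, p₃] = (Psq p₀ p₁ p₂ p₃ x y)ᵀ := by
  ext i j
  fin_cases i <;> fin_cases j <;>
    simp [minusDsq, twoComponent, Psq, leviCivita, Fin.sum_univ_four, Fin.sum_univ_three, Matrix.transpose_apply] <;> ring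

/-- … equivalently the entrywise complex conjugate of (VI.8) (all of `p, x, y` real). [cite: MagnenRivasseauSeneor1993, §VI (VI.3), (VI.8) pp.369–370] -/
theorem minusDsq_twoComponent_eq_conj (p₀ p₁ p₂ p₃ x y : ℝ) :
    minusDsq (twoComponent x y) ![p₀, p₁, p₂, p₃] = (Psq p₀ p₁ p₂ p₃ x y).map (starRingEnd ℂ) := by
  rw [minusDsq_twoComponent]
  ext i j
  fin_cases i <;> fin_cases j <;> simp [Psq, Matrix.transpose_apply, Complex.ext_iff]

/-- The (VI.3) matrix at the two-component background is Hermitian. [cite: MagnenRivasseauSeneor1993, §VI (VI.3) p.369] -/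
theorem minusDsq_twoComponent_conjTranspose (p₀ p₁ p₂ p₃ x y : ℝ) :
    (minusDsq (twoComponent x y) ![p₀, p₁, p₂, p₃])ᴴ = minusDsq (twoComponent x y) ![p₀, p₁, p₂, p₃] := by
  rw [minusDsq_twoComponent, Matrix.conjTranspose, Matrix.transpose_transpose]
  ext i j
  fin_cases i <;> fin_cases j <;> simp [Psq, Matrix.transpose_apply, Complex.ext_iff]

/-- … and it is NOT (VI.8) itself unless `p₂y = 0` (and `p₁x = 0`): the `(1, 3)` entries are `−2ip₂y` (from (VI.3)) versus `+2ip₂y`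
(printed (VI.8)) — the sign/transposition convention mismatch recorded in the module docstring.
[cite: MagnenRivasseauSeneor1993, §VI (VI.3) p.369, (VI.8) p.370] -/
theorem minusDsq_twoComponent_ne_Psq {p₀ p₁ p₂ p₃ x y : ℝ} (h : p₂ * y ≠ 0) :
    minusDsq (twoComponent x y) ![p₀, p₁, p₂, p₃] ≠ Psq p₀ p₁ p₂ p₃ x y := by
  rw [minusDsq_twoComponent]
  intro hE
  have h02 := congrFun (congrFun hE 0) 2
  simp [Psq, Matrix.transpose_apply] at h02
  have : (p₂ : ℂ) * (y : ℂ) = 0 := by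
    have hI : (I : ℂ) ≠ 0 := Complex.I_ne_zero
    have h4 : (2 : ℂ) * I * p₂ * y = 0 := by linear_combination (-1 / 2 : ℂ) * h02
    simpa [hI] using h4
  apply h
  exact_mod_cast this

end FeynmanGauge

end Literature.MathematicalPhysics.QuantumFieldTheory.MagnenRivasseauSeneor1993
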